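import Summits.QuantumFields.BalabanUV.Beta.D1BFx.GluonLocalNdlWord

/-!
# `BalabanUV.Beta.D1BFx.GluonLocalNdlRow` — road «BF-x» for binder row D1, slot (K), END row `hGrp gN`, «GN-Q»: THE `SbT ⊗ ndlPiece` PIECE OF THE GLUON NEEDLE
# ROW T₁ IS n-UNIFORM — `|cellSum n a SbT (ndlPiece n a (cQ n)) μ ν| ≤ C_Q` for every `n ≥ 1`, ONE `C_Q = C(a, cQ₀) ≥ 0`, modulo [B5, Prop. 1.2] ∧ [B5, (1.126)–(1.127)]
# BY NAME and `|cQ n| ≤ cQ₀` (P13) — the hypothesis `hn` of `GluonNeedleGlueT12.h₁_of_pieces`, on the OWNER's frame `LocalVertexForm.exists_SbT_outer_bound`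

HONEST DEPENDENCY (cell records, verbatim): «continuum YM on T⁴ ⇐ BetaPertH ∧ nine spine estimates (0/9 proved); BetaPertH ⇐ (D1) ∧ (D4) ∧
CAP+tail; G-an2-4 gates asym, D1 and NE2/3/4.»  HONEST FRAMING (cell contract, verbatim): «discharging `BetaPertH` makes Bałaban's UV stability
UNCONDITIONAL — a real constructive-QFT result; it is NOT the continuum limit and NOT the Clay problem.»  THIS MODULE DISCHARGES NOTHING of the
wall: [folklore] counting BY NAME on the owner's frame `LocalVertexForm.exists_SbT_outer_bound` (absolute `K`, `R`) and window shifts `GluonLocalProjWord.profile_window`,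
the owner's `NeedleNdlShape.ndlPiece_eq_outer` ∕ `locV_ndlRow` ∕ `locV_combinedColumn` and column letters `NeedleColumnLetters.exists_applyK_gradC_le` ∕ `abs_gradC_le` ∕
`applyKT_eq_applyK_of_symm`, this seat's `NeedleNdlProjLetters.exists_applyK_grad_row_le`, `GluonLocalNdlLetters.exists_applyK_grad_row_diff_le` ∕ `exists_applyK_gradC_diff_le`
and `NeedleProjNdlRow.abs_weight_le_of_mem_B` ∕ `sum_resSite_needle_weight_le` (the base-average census over M7), leaf-04-g9's damped moments and
`LatticeHLSPairing.abs_fullSum_le_of_abs_sum_le`, `SectorRecut.exists_biLoc_SbT`, `RankOneBubble.bubble_outer_sub_right`.  No `def`, no `def … : Prop`, nothing cited,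
0 sorry; the printed statements are HYPOTHESES by name.  Root-level binders hW ∕ hR-sockets ∕ hSX-socket ∕ D1Tel ∕ D1Rep — 0 discharged; (K) NOT closed (T₁ pieces: P
(owner) + Q̇ (this file); K open; T₂ mirrors after the transposed frame); NOT D1, NOT `BetaPertH`, NOT continuum, NOT Clay.

ABSOLUTE RULE (cell charter, verbatim): «No internally-minted statement may enter as a cited fact. Every hypothesis is either kernel-proved in
this package or a verbatim quotation of a PUBLISHED theorem with page reference. The manuscript(s) under audit are NOT citable for their own
disputed steps — they are the thing under adjudication; programme-internal (2001/route/tribunal) claims are never citable.»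

WHY (owner claim table «GN-CELLS» v0.2, row «T₁∕T₂ K-piece, Q̇-piece»; l.31129 «GN-Q … first refusal leaf-01»; MINE l.31184).  THE COUNT.  The word at `(b, w)` is
`−½·bubble Ga (SbT μ (b+w)) (ndlPiece ν b)` and `ndlPiece ν b = ∇C_b ⊗ ∇ρ_b − ∇ρ_b ⊗ ∇C_b` (`ndlPiece_eq_outer`): two rank-one terms, each bounded by the frame
`K·(Φ₁Γ₀ + Φ₀Γ₁ + Φ₁Γ₁)` from the window letters of its two ends around the vertex `u = b + w` (radius `R`).  The needle end `Ga∇ρ_b` has `Φ₀ = (kΦ∕n²)·c₁·Σ_s|qJet_b s|E₁(u−s)`,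
`Φ₁ = (kΦ′∕n²)·c₂·Σ_s|qJet_b s|E₂(u−s)` (`E_p(v) = e^{−(ε∕n)‖v‖}∕nrm(v)^p`, window shift `c_p = e^{εR}(R+1)^p`); the column end `Ga∇C_b` has the sups `Γ₀ = kN·C₁·n`, `Γ₁ = kN′·C₁`
(`C₁ = cQ₀·cPPs + cPs`).  The three products are `Σ_s|qJet_b s|·[n⁻¹E₂ + n⁻²E₁ + n⁻²E₂](u−s)` up to constants; the (1.22) sum has NO needle weight under it (the needle sits at
the base): `|w_μw_ν| ≤ 2‖u−s‖² + 2n²` and the damped moments give `Σ_w|w_μw_ν|E₂ ≍ n⁴`, `Σ_w|w_μw_ν|E₁ ≍ n⁵`, so ONE base site costs `q_b·n³·G₀` (`q_b = Σ_s|qJet_b s|`), and the base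
average pays: `n⁻⁴·Σ_{b∈image resSite} q_b ≤ (n−1)·n⁻⁴` (M7) ⇒ `((n−1)∕n)·G₀ ≤ G₀`.  n⁰ with NO cancellation (an3 predicted n⁻¹ for this piece; n⁰ is what `hn` needs).

CONTENT (`a > 0`, `n ≥ 1`).
* (part 1 `GluonLocalNdlWord.abs_locNdl_word_le` — the pointwise bound from the frame and abstract letters.)
* §2 [folklore] `sum_weight_prof_le` (the weighted damped moment against a base-block site, any `p ≤ 3`), **`abs_fullSum_locNdl_le`** (`|fullSum_b| ≤ q_b·K·((KΦ′c₂T₂)(KN+KN′) + (KΦc₁T₁)KN′)`).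
* §3 [folklore] **`exists_locNdl_row_le`** — `∃ C ≥ 0, ∀ n [NeZero n], |cellSum n a SbT (ndlPiece n a (cQ n)) μ ν| ≤ C` modulo `h12`∕`h126` and `hcQ` (`G_n ≤ n³G₀`, base average).
NOT HERE (honest): the K-piece «GN-K»; the T₂ mirrors (owner's transposed frame); the `h₁` glue (owner, `GluonNeedleGlueT12.h₁_of_pieces`).
Unit `b2b-balaban-beta-d1-formalise-leaf-01` (gen 15), D1 formalisation swarm LEAF PROVER 01 on cross-road kernel duty; `LEAVES-BFx.md` row (N) «GN-Q».
-/

noncomputable section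

namespace Summit.QuantumFields.BalabanUV.Beta.D1BFx.GluonLocalNdlRow

open Finset
open scoped BigOperators
open Literature.MathematicalPhysics.QuantumFieldTheory.Balaban1983to89
open Literature.MathematicalPhysics.QuantumFieldTheory.Balaban1983to89.Beta
open B12Sec2to5 (l1 l1_nonneg)
open B4Sect5Proof (latticeConst latticeConst_nonneg)
open B6QGQLower276 (X e blk B mem_B)
open B6QGQDecay237 (card_B)
open ExpKernelCalculus (Site MKer Decays bubble summable_exp_shift summable_exp_shift')
open DyadicShell (Pt toReal toReal_apply)
open WindowIdentification (fullSum)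
open DressedMomentNormalisation (resSite)
open AffineAveraging (unitVec)
open VectorTailsLoc (fam kfam)
open Beta.PoissonInterior (nrm nrm_pos one_le_nrm nrm_neg supNorm_le_nrm)
open Summit.QuantumFields.BalabanUV.Beta.TameKernelCalculus (Spr Loc)
open Summit.QuantumFields.BalabanUV.Beta.D1BFx.PackedKernelSplit (biBubble bubble_eq_biBubble)
open Summit.QuantumFields.BalabanUV.Beta.D1BFx.FineHessianSectors (biBubbleTable biBubbleTable_apply)
open Summit.QuantumFields.BalabanUV.Beta.D1BFx.RProjector (Pgt kerP deltaPP deltaP deltaPP_pos deltaP_pos)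
open Summit.QuantumFields.BalabanUV.Beta.D1BFx.ProjectorSupNorm (cPPs cPs cPPs_nonneg cPs_nonneg)
open Summit.QuantumFields.BalabanUV.Beta.D1BFx.GluonLeg (Ga Ga_apply Ga_symm)
open Summit.QuantumFields.BalabanUV.Beta.D1BFx.GluonLegTails (spr_Ga_of_prop12)
open Summit.QuantumFields.BalabanUV.Beta.D1BFx.FrozenLegTails (nOf MOf hn1)
open Summit.QuantumFields.BalabanUV.Beta.D1BFx.GhostLeg (cast_pred_add_one)
open Summit.QuantumFields.BalabanUV.Beta.D1BFx.GhostStencil (qJet)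
open Summit.QuantumFields.BalabanUV.Beta.D1BFx.SectorRecut (SbT exists_biLoc_SbT)
open Summit.QuantumFields.BalabanUV.Beta.D1BFx.GluonNeedleSplit (ndlPiece)
open Summit.QuantumFields.BalabanUV.Beta.D1BFx.GluonNeedleGlue (cellSum cellSum_def)
open Summit.QuantumFields.BalabanUV.Beta.D1BFx.RankOneBubble (outer applyK applyKT pairing applyK_apply applyKT_apply bubble_outer_sub_right LocV)
open Summit.QuantumFields.BalabanUV.Beta.D1BFx.RankOneBubbleJets (grad grad_apply locV_grad_of_locV)
open Summit.QuantumFields.BalabanUV.Beta.D1BFx.NeedlePotentialLetters (ndlRow abs_ndlRow_diff_le)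
open Summit.QuantumFields.BalabanUV.Beta.D1BFx.RColumnBlockMass (dR cRd dR_pos cRd_nonneg)
open Summit.QuantumFields.BalabanUV.Beta.D1BFx.NeedleNdlShape (ndlPiece_eq_outer locV_ndlRow locV_combinedColumn)
open Summit.QuantumFields.BalabanUV.Beta.D1BFx.NeedleColumnLetters (applyKT_eq_applyK_of_symm abs_gradC_le exists_applyK_gradC_le)
open Summit.QuantumFields.BalabanUV.Beta.D1BFx.NeedleNdlProjLetters (exists_applyK_grad_row_le)
open Summit.QuantumFields.BalabanUV.Beta.D1BFx.GluonLocalNdlLetters (exists_applyK_grad_row_diff_le exists_applyK_gradC_diff_le)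
open Summit.QuantumFields.BalabanUV.Beta.D1BFx.NeedleProjNdlRow (abs_weight_le_of_mem_B sum_resSite_needle_weight_le)
open Summit.QuantumFields.BalabanUV.Beta.D1BFx.GluonLocalProjWord (profile_window)
open Summit.QuantumFields.BalabanUV.Beta.D1BFx.LatticeHLSProfiles (supNorm_dyadic)
open Summit.QuantumFields.BalabanUV.Beta.D1BFx.LatticeHLSPairing (abs_fullSum_le_of_abs_sum_le)
open Summit.QuantumFields.BalabanUV.Beta.D1BFx.LocalVertexForm (exists_SbT_outer_bound)
open Summit.QuantumFields.BalabanUV.Beta.D1BFx.GluonLocalNdlWord (abs_locNdl_word_le)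

variable (n : ℕ) [NeZero n] (a : ℝ)

/-! ## §2 The (1.22) sum at one base site: the base needle weight comes out, the `w`-sums are damped moments -/

variable {n} in
/-- [folklore] the weighted damped-profile sum against a base-block site, any exponent `p ≤ 3`: for `s ∈ B(blk b)`,
`Σ_{w∈S} |w_μw_ν|·e^{−(ε∕n)‖b+w−s‖}∕nrm(b+w−s)^p ≤ 2·(C₂·n^{4−p+2}) + 2n²·(C₀·n^{4−p+0})` (`|w_μw_ν| ≤ 2‖b+w−s‖² + 2n²` and leaf-04-g9's damped moments). -/
theorem sum_weight_prof_le {ε : ℝ} (hε : 0 < ε) {p : ℕ} (hp : p ≤ 3) (μ ν : Fin 4) (b s : Pt) (hs : s ∈ B (n - 1) (blk (n - 1) b)) (S : Finset Pt) :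
    ∑ w ∈ S, |toReal w μ * toReal w ν| * (Real.exp (-(ε / n) * PoissonInterior.supNorm (d := 4) (b + w - s)) / nrm (b + w - s) ^ p)
      ≤ 2 * (2 * (Nat.factorial 2) * (2 / ε) ^ 2 * (1 + 2 * (4 : ℕ) * 3 ^ (4 - 1) * ((Nat.factorial (4 - 1 - p)) * (4 / ε) ^ (4 - 1 - p) * (1 + 4 / ε)))
            * (n : ℝ) ^ (4 - p + 2))
        + 2 * (n : ℝ) ^ 2 * (2 * (Nat.factorial 0) * (2 / ε) ^ 0 * (1 + 2 * (4 : ℕ) * 3 ^ (4 - 1) * ((Nat.factorial (4 - 1 - p)) * (4 / ε) ^ (4 - 1 - p) * (1 + 4 / ε)))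
            * (n : ℝ) ^ (4 - p + 0)) := by
  have hn1 : 1 ≤ n := NeZero.one_le
  have hp' : p ≤ 4 - 1 := by omega
  have hprof0 : ∀ w : Pt, 0 ≤ Real.exp (-(ε / n) * PoissonInterior.supNorm (d := 4) (b + w - s)) / nrm (b + w - s) ^ p := fun w =>
    div_nonneg (Real.exp_pos _).le (pow_nonneg (nrm_pos _).le p)
  have hq := LatticeHLSProfiles.sum_pow_mul_exp_div_nrm_pow_free_scale_le (d := 4) (by norm_num) hε hn1 hp' 2 (S.map (addLeftEmbedding b)) s s
  have h0 := LatticeHLSProfiles.sum_pow_mul_exp_div_nrm_pow_free_scale_le (d := 4) (by norm_num) hε hn1 hp' 0 (S.map (addLeftEmbedding b)) s s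
  rw [Finset.sum_map] at hq h0
  have hq' : ∑ w ∈ S, (PoissonInterior.supNorm (d := 4) (b + w - s) : ℝ) ^ 2 *
      (Real.exp (-(ε / n) * PoissonInterior.supNorm (d := 4) (b + w - s)) / nrm (b + w - s) ^ p) ≤ _ :=
    le_trans (le_of_eq (Finset.sum_congr rfl fun w _ => by rw [addLeftEmbedding_apply, mul_div_assoc])) hq
  have h0' : ∑ w ∈ S, (Real.exp (-(ε / n) * PoissonInterior.supNorm (d := 4) (b + w - s)) / nrm (b + w - s) ^ p) ≤ _ :=
    le_trans (le_of_eq (Finset.sum_congr rfl fun w _ => by rw [addLeftEmbedding_apply, pow_zero, one_mul])) h0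
  calc ∑ w ∈ S, |toReal w μ * toReal w ν| * (Real.exp (-(ε / n) * PoissonInterior.supNorm (d := 4) (b + w - s)) / nrm (b + w - s) ^ p)
      ≤ ∑ w ∈ S, (2 * (PoissonInterior.supNorm (d := 4) (b + w - s) : ℝ) ^ 2 + 2 * (n : ℝ) ^ 2) *
          (Real.exp (-(ε / n) * PoissonInterior.supNorm (d := 4) (b + w - s)) / nrm (b + w - s) ^ p) :=
        Finset.sum_le_sum fun w _ => mul_le_mul_of_nonneg_right (abs_weight_le_of_mem_B n b w s hs μ ν) (hprof0 w)
    _ = 2 * ∑ w ∈ S, (PoissonInterior.supNorm (d := 4) (b + w - s) : ℝ) ^ 2 *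
          (Real.exp (-(ε / n) * PoissonInterior.supNorm (d := 4) (b + w - s)) / nrm (b + w - s) ^ p)
        + 2 * (n : ℝ) ^ 2 * ∑ w ∈ S, (Real.exp (-(ε / n) * PoissonInterior.supNorm (d := 4) (b + w - s)) / nrm (b + w - s) ^ p) := by
        rw [Finset.mul_sum, Finset.mul_sum, ← Finset.sum_add_distrib]
        exact Finset.sum_congr rfl fun w _ => by ring
    _ ≤ _ := add_le_add (mul_le_mul_of_nonneg_left hq' (by norm_num)) (mul_le_mul_of_nonneg_left h0' (by positivity))

/-- [folklore] **THE (1.22) SUM OF THE `SbT ⊗ ndl` WORD AT ONE BASE SITE, FROM THE FRAME AND ABSTRACT LETTERS**: for every base site `b`,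
`|fullSum (w ↦ w_μw_ν·word(b,w))| ≤ (Σ_{s∈B(blk b)}|qJet_b s|)·K·((KΦ′c₂·T₂)·(KN+KN′) + (KΦc₁·T₁)·KN′)` with the damped-moment totals `T_p = 2C₂ₚn^{6−p} + 2n²C₀ₚn^{4−p}` of
`sum_weight_prof_le` — the BASE bond's needle weight is a common factor (leaf-04-g9's `abs_fullSum_le_of_abs_sum_le` closes the series from the finite sums). -/
theorem abs_fullSum_locNdl_le (ha : 0 < a) (hA : Spr (Ga n a)) {K : ℝ} {R : ℕ} (hK : 0 ≤ K)
    (hframe : ∀ (κ : Fin 4) (u : Pt) (A B : MKer 4 (Fin 4)) (φ ψ : Pt → Fin 4 → ℝ),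
      (∀ (s : Pt) (g : Fin 4), Summable fun x : Pt => ∑ a', ψ x a' * A x s a' g) →
      ∀ (Φ₀ Φ₁ Γ₀ Γ₁ : ℝ), 0 ≤ Φ₀ → 0 ≤ Φ₁ → 0 ≤ Γ₀ → 0 ≤ Γ₁ →
      (∀ (q : Pt) (g : Fin 4), DyadicShell.supNorm (q - u) ≤ R → |applyKT ψ A q g| ≤ Φ₀) →
      (∀ (q : Pt) (g : Fin 4) (i : Fin 4), DyadicShell.supNorm (q - u) ≤ R → |applyKT ψ A (q + unitVec i) g - applyKT ψ A q g| ≤ Φ₁) →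
      (∀ (q : Pt) (f : Fin 4), DyadicShell.supNorm (q - u) ≤ R → |applyK B φ q f| ≤ Γ₀) →
      (∀ (q : Pt) (f : Fin 4) (i : Fin 4), DyadicShell.supNorm (q - u) ≤ R → |applyK B φ (q + unitVec i) f - applyK B φ q f| ≤ Γ₁) →
      |biBubble A (SbT κ u) B (outer φ ψ)| ≤ K * (Φ₁ * Γ₀ + Φ₀ * Γ₁ + Φ₁ * Γ₁))
    {cQ KΦ KΦ' KN KN' ε : ℝ} (hKΦ : 0 ≤ KΦ) (hKΦ' : 0 ≤ KΦ') (hKN : 0 ≤ KN) (hKN' : 0 ≤ KN') (hε : 0 < ε)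
    (hΦ : ∀ (κ : Fin 4) (u x : Pt) (α : Fin 4), |applyK (Ga n a) (grad (ndlRow n a κ u)) x α|
      ≤ KΦ * ∑ s ∈ B (n - 1) (blk (n - 1) u), |qJet n κ u (blk (n - 1) u) s|
          * (Real.exp (-(ε / n) * PoissonInterior.supNorm (d := 4) (x - s)) / nrm (x - s) ^ 1))
    (hΦ' : ∀ (κ : Fin 4) (u x : Pt) (α i : Fin 4), |applyK (Ga n a) (grad (ndlRow n a κ u)) (x + unitVec i) α - applyK (Ga n a) (grad (ndlRow n a κ u)) x α|
      ≤ KΦ' * ∑ s ∈ B (n - 1) (blk (n - 1) u), |qJet n κ u (blk (n - 1) u) s|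
          * (Real.exp (-(ε / n) * PoissonInterior.supNorm (d := 4) (x - s)) / nrm (x - s) ^ 2))
    (hN : ∀ (u x : Pt) (α : Fin 4), |applyK (Ga n a)
        (grad (fun q => cQ * (∑ z ∈ B (n - 1) (blk (n - 1) u), Pgt n a z q () ()) - kerP (d := 4) (n - 1) a q (blk (n - 1) u))) x α| ≤ KN)
    (hN' : ∀ (u x : Pt) (α i : Fin 4), |applyK (Ga n a)
        (grad (fun q => cQ * (∑ z ∈ B (n - 1) (blk (n - 1) u), Pgt n a z q () ()) - kerP (d := 4) (n - 1) a q (blk (n - 1) u))) (x + unitVec i) α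
        - applyK (Ga n a) (grad (fun q => cQ * (∑ z ∈ B (n - 1) (blk (n - 1) u), Pgt n a z q () ()) - kerP (d := 4) (n - 1) a q (blk (n - 1) u))) x α|
        ≤ KN')
    (μ ν : Fin 4) (b : Pt) :
    |fullSum (fun w : Pt => toReal w μ * toReal w ν * biBubbleTable (Ga n a) (Ga n a) SbT (ndlPiece n a cQ) μ ν (b + w) b)|
      ≤ (∑ s ∈ B (n - 1) (blk (n - 1) b), |qJet n ν b (blk (n - 1) b) s|) * (K *
        ((KΦ' * (Real.exp (ε * R) * ((R : ℝ) + 1) ^ 2) *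
          (2 * (2 * (Nat.factorial 2) * (2 / ε) ^ 2 * (1 + 2 * (4 : ℕ) * 3 ^ (4 - 1) * ((Nat.factorial (4 - 1 - 2)) * (4 / ε) ^ (4 - 1 - 2) * (1 + 4 / ε)))
              * (n : ℝ) ^ (4 - 2 + 2))
            + 2 * (n : ℝ) ^ 2 * (2 * (Nat.factorial 0) * (2 / ε) ^ 0 * (1 + 2 * (4 : ℕ) * 3 ^ (4 - 1) * ((Nat.factorial (4 - 1 - 2)) * (4 / ε) ^ (4 - 1 - 2) * (1 + 4 / ε)))
              * (n : ℝ) ^ (4 - 2 + 0)))) * (KN + KN')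
        + (KΦ * (Real.exp (ε * R) * ((R : ℝ) + 1) ^ 1) *
          (2 * (2 * (Nat.factorial 2) * (2 / ε) ^ 2 * (1 + 2 * (4 : ℕ) * 3 ^ (4 - 1) * ((Nat.factorial (4 - 1 - 1)) * (4 / ε) ^ (4 - 1 - 1) * (1 + 4 / ε)))
              * (n : ℝ) ^ (4 - 1 + 2))
            + 2 * (n : ℝ) ^ 2 * (2 * (Nat.factorial 0) * (2 / ε) ^ 0 * (1 + 2 * (4 : ℕ) * 3 ^ (4 - 1) * ((Nat.factorial (4 - 1 - 1)) * (4 / ε) ^ (4 - 1 - 1) * (1 + 4 / ε)))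
              * (n : ℝ) ^ (4 - 1 + 0)))) * KN')) := by
  set m : ℕ := n - 1 with hm
  set c₁ : ℝ := Real.exp (ε * R) * ((R : ℝ) + 1) ^ 1 with hc₁
  set c₂ : ℝ := Real.exp (ε * R) * ((R : ℝ) + 1) ^ 2 with hc₂
  set T₂ : ℝ := 2 * (2 * (Nat.factorial 2) * (2 / ε) ^ 2 * (1 + 2 * (4 : ℕ) * 3 ^ (4 - 1) * ((Nat.factorial (4 - 1 - 2)) * (4 / ε) ^ (4 - 1 - 2) * (1 + 4 / ε)))
        * (n : ℝ) ^ (4 - 2 + 2))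
      + 2 * (n : ℝ) ^ 2 * (2 * (Nat.factorial 0) * (2 / ε) ^ 0 * (1 + 2 * (4 : ℕ) * 3 ^ (4 - 1) * ((Nat.factorial (4 - 1 - 2)) * (4 / ε) ^ (4 - 1 - 2) * (1 + 4 / ε)))
        * (n : ℝ) ^ (4 - 2 + 0)) with hT₂
  set T₁ : ℝ := 2 * (2 * (Nat.factorial 2) * (2 / ε) ^ 2 * (1 + 2 * (4 : ℕ) * 3 ^ (4 - 1) * ((Nat.factorial (4 - 1 - 1)) * (4 / ε) ^ (4 - 1 - 1) * (1 + 4 / ε)))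
        * (n : ℝ) ^ (4 - 1 + 2))
      + 2 * (n : ℝ) ^ 2 * (2 * (Nat.factorial 0) * (2 / ε) ^ 0 * (1 + 2 * (4 : ℕ) * 3 ^ (4 - 1) * ((Nat.factorial (4 - 1 - 1)) * (4 / ε) ^ (4 - 1 - 1) * (1 + 4 / ε)))
        * (n : ℝ) ^ (4 - 1 + 0)) with hT₁
  set Wq : Pt → ℝ := fun s => |qJet n ν b (blk m b) s| with hWq
  set E : ℕ → Pt → Pt → ℝ := fun p w s => Real.exp (-(ε / n) * PoissonInterior.supNorm (d := 4) (b + w - s)) / nrm (b + w - s) ^ p with hE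
  have hE0 : ∀ p w s, 0 ≤ E p w s := fun p w s => div_nonneg (Real.exp_pos _).le (pow_nonneg (nrm_pos _).le p)
  have hW0 : 0 ≤ ∑ s ∈ B m (blk m b), Wq s := Finset.sum_nonneg fun s _ => abs_nonneg _
  -- the two weighted damped-moment sums
  have hS₂ : ∀ (S : Finset Pt) (s : Pt), s ∈ B m (blk m b) → ∑ w ∈ S, |toReal w μ * toReal w ν| * E 2 w s ≤ T₂ :=
    fun S s hs => sum_weight_prof_le hε (p := 2) (by norm_num) μ ν b s hs S
  have hS₁ : ∀ (S : Finset Pt) (s : Pt), s ∈ B m (blk m b) → ∑ w ∈ S, |toReal w μ * toReal w ν| * E 1 w s ≤ T₁ :=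
    fun S s hs => sum_weight_prof_le hε (p := 1) (by norm_num) μ ν b s hs S
  -- the pointwise domination, reorganised with the base needle weight outside
  have hsplit : ∀ w : Pt, ∑ s ∈ B m (blk m b), Wq s * (K * ((KΦ' * c₂ * (KN + KN')) * (|toReal w μ * toReal w ν| * E 2 w s)
          + (KΦ * c₁ * KN') * (|toReal w μ * toReal w ν| * E 1 w s)))
      = |toReal w μ * toReal w ν| * (K * ((KΦ' * c₂ * ∑ s ∈ B m (blk m b), Wq s * E 2 w s) * (KN + KN')
          + (KΦ * c₁ * ∑ s ∈ B m (blk m b), Wq s * E 1 w s) * KN')) := by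
    intro w
    have e : ∀ s : Pt, Wq s * (K * ((KΦ' * c₂ * (KN + KN')) * (|toReal w μ * toReal w ν| * E 2 w s)
          + (KΦ * c₁ * KN') * (|toReal w μ * toReal w ν| * E 1 w s)))
        = (|toReal w μ * toReal w ν| * K * (KΦ' * c₂ * (KN + KN'))) * (Wq s * E 2 w s)
          + (|toReal w μ * toReal w ν| * K * (KΦ * c₁ * KN')) * (Wq s * E 1 w s) := fun s => by ring
    rw [Finset.sum_congr rfl fun s _ => e s, Finset.sum_add_distrib, ← Finset.mul_sum, ← Finset.mul_sum]
    ring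
  have hdom : ∀ w : Pt, |toReal w μ * toReal w ν * biBubbleTable (Ga n a) (Ga n a) SbT (ndlPiece n a cQ) μ ν (b + w) b|
      ≤ ∑ s ∈ B m (blk m b), Wq s * (K * ((KΦ' * c₂ * (KN + KN')) * (|toReal w μ * toReal w ν| * E 2 w s)
          + (KΦ * c₁ * KN') * (|toReal w μ * toReal w ν| * E 1 w s))) := by
    intro w
    have h := abs_locNdl_word_le n a ha hA hframe hKΦ hKΦ' hKN hKN' hε hΦ hΦ' hN hN' μ ν b w
    rw [abs_mul, hsplit w]
    exact mul_le_mul_of_nonneg_left h (abs_nonneg _)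
  have hfin : ∀ S : Finset Pt, ∑ w ∈ S, |toReal w μ * toReal w ν * biBubbleTable (Ga n a) (Ga n a) SbT (ndlPiece n a cQ) μ ν (b + w) b|
      ≤ (∑ s ∈ B m (blk m b), Wq s) * (K * ((KΦ' * c₂ * T₂) * (KN + KN') + (KΦ * c₁ * T₁) * KN')) := by
    intro S
    calc ∑ w ∈ S, |toReal w μ * toReal w ν * biBubbleTable (Ga n a) (Ga n a) SbT (ndlPiece n a cQ) μ ν (b + w) b|
        ≤ ∑ w ∈ S, ∑ s ∈ B m (blk m b), Wq s * (K * ((KΦ' * c₂ * (KN + KN')) * (|toReal w μ * toReal w ν| * E 2 w s)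
            + (KΦ * c₁ * KN') * (|toReal w μ * toReal w ν| * E 1 w s))) := Finset.sum_le_sum fun w _ => hdom w
      _ = ∑ s ∈ B m (blk m b), Wq s * (K * ((KΦ' * c₂ * (KN + KN')) * ∑ w ∈ S, |toReal w μ * toReal w ν| * E 2 w s
            + (KΦ * c₁ * KN') * ∑ w ∈ S, |toReal w μ * toReal w ν| * E 1 w s)) := by
          rw [Finset.sum_comm]
          refine Finset.sum_congr rfl fun s _ => ?_
          rw [Finset.mul_sum, Finset.mul_sum, ← Finset.sum_add_distrib, Finset.mul_sum, Finset.mul_sum]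
      _ ≤ ∑ s ∈ B m (blk m b), Wq s * (K * ((KΦ' * c₂ * (KN + KN')) * T₂ + (KΦ * c₁ * KN') * T₁)) := by
          refine Finset.sum_le_sum fun s hs => mul_le_mul_of_nonneg_left (mul_le_mul_of_nonneg_left (add_le_add
            (mul_le_mul_of_nonneg_left (hS₂ S s hs) (by positivity)) (mul_le_mul_of_nonneg_left (hS₁ S s hs) (by positivity))) hK) (abs_nonneg _)
      _ = (∑ s ∈ B m (blk m b), Wq s) * (K * ((KΦ' * c₂ * T₂) * (KN + KN') + (KΦ * c₁ * T₁) * KN')) := by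
          rw [Finset.sum_mul]; exact Finset.sum_congr rfl fun s _ => by ring
  have h := (abs_fullSum_le_of_abs_sum_le hfin).2
  refine h.trans (le_of_eq ?_)
  rw [hWq, hc₁, hc₂, hT₂, hT₁]

/-! ## §3 The piece: letters instantiated, the census paid at the base average -/

variable {n}

/-- [folklore] **«GN-Q»: THE `SbT ⊗ ndlPiece` PIECE OF T₁ IS n-UNIFORM** — the hypothesis `hn` of `GluonNeedleGlueT12.h₁_of_pieces`, modulo [B5, Prop. 1.2] ∧
[B5, (1.126)–(1.127)] BY NAME and a uniform bound `cQ₀` on the stencil weight `cQ n` (P13: `C = C(a, cQ₀)`): one `C ≥ 0` with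
`|cellSum n a SbT (ndlPiece n a (cQ n)) μ ν| ≤ C` for every `n ≥ 1` (per base site `q_b·n³·G₀` from the owner's frame `exists_SbT_outer_bound`; the base average pays `n⁻⁴·Σ_b q_b ≤ (n−1)n⁻⁴`). -/
theorem exists_locNdl_row_le (ha : 0 < a) (h12 : B5.Prop12Printed (fam nOf hn1 MOf a ha)) (h126 : B5.Kernel126_127Printed (kfam nOf MOf))
    {cQ : ℕ → ℝ} {cQ₀ : ℝ} (hcQ : ∀ n, |cQ n| ≤ cQ₀) (μ ν : Fin 4) :
    ∃ C : ℝ, 0 ≤ C ∧ ∀ (n : ℕ) [NeZero n], |cellSum n a SbT (ndlPiece n a (cQ n)) μ ν| ≤ C := by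
  obtain ⟨K, R, hK, hframe⟩ := exists_SbT_outer_bound
  obtain ⟨kΦ, ε₀, hε₀, hkΦ, hΦ⟩ := exists_applyK_grad_row_le a ha h12 h126
  obtain ⟨kΦ', ε₁, hε₁, hkΦ', hΦ'⟩ := exists_applyK_grad_row_diff_le a ha h12 h126
  obtain ⟨kN, δ₂, hδ₂, hkN, hN⟩ := exists_applyK_gradC_le a ha h12 h126
  obtain ⟨kN', hkN', hN'⟩ := exists_applyK_gradC_diff_le a ha h12 h126
  have hcP := cPPs_nonneg 4 ha; have hcs := cPs_nonneg 4 ha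
  have hcQ₀ : 0 ≤ cQ₀ := (abs_nonneg _).trans (hcQ 0)
  set ε : ℝ := min ε₀ ε₁ with hεd
  have hε : 0 < ε := lt_min hε₀ hε₁
  have hl0 : ε ≤ ε₀ := min_le_left _ _
  have hl1 : ε ≤ ε₁ := min_le_right _ _
  set C₁ : ℝ := cQ₀ * cPPs 4 a + cPs 4 a with hC₁
  have hC₁0 : 0 ≤ C₁ := by positivity
  set c₁ : ℝ := Real.exp (ε * R) * ((R : ℝ) + 1) ^ 1 with hc₁
  set c₂ : ℝ := Real.exp (ε * R) * ((R : ℝ) + 1) ^ 2 with hc₂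
  set A₂ : ℝ := 2 * (Nat.factorial 2) * (2 / ε) ^ 2 * (1 + 2 * (4 : ℕ) * 3 ^ (4 - 1) * ((Nat.factorial (4 - 1 - 2)) * (4 / ε) ^ (4 - 1 - 2) * (1 + 4 / ε))) with hA₂
  set B₂ : ℝ := 2 * (Nat.factorial 0) * (2 / ε) ^ 0 * (1 + 2 * (4 : ℕ) * 3 ^ (4 - 1) * ((Nat.factorial (4 - 1 - 2)) * (4 / ε) ^ (4 - 1 - 2) * (1 + 4 / ε))) with hB₂
  set A₁ : ℝ := 2 * (Nat.factorial 2) * (2 / ε) ^ 2 * (1 + 2 * (4 : ℕ) * 3 ^ (4 - 1) * ((Nat.factorial (4 - 1 - 1)) * (4 / ε) ^ (4 - 1 - 1) * (1 + 4 / ε))) with hA₁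
  set B₁ : ℝ := 2 * (Nat.factorial 0) * (2 / ε) ^ 0 * (1 + 2 * (4 : ℕ) * 3 ^ (4 - 1) * ((Nat.factorial (4 - 1 - 1)) * (4 / ε) ^ (4 - 1 - 1) * (1 + 4 / ε))) with hB₁
  have hA₂0 : 0 ≤ A₂ := by positivity
  have hB₂0 : 0 ≤ B₂ := by positivity
  have hA₁0 : 0 ≤ A₁ := by positivity
  have hB₁0 : 0 ≤ B₁ := by positivity
  set G₀ : ℝ := K * C₁ * (kΦ' * c₂ * (2 * A₂ + 2 * B₂) * (kN + kN') + kΦ * c₁ * (2 * A₁ + 2 * B₁) * kN') with hG₀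
  have hG₀0 : 0 ≤ G₀ := by positivity
  refine ⟨G₀, hG₀0, fun n _ => ?_⟩
  have hn : (0 : ℝ) < n := by exact_mod_cast Nat.pos_of_ne_zero (NeZero.ne n)
  have hn1 : (1 : ℝ) ≤ n := by exact_mod_cast NeZero.one_le
  have hA : Spr (Ga n a) := spr_Ga_of_prop12 (a := a) (ha := ha) h12 h126 n
  have hC₀ : |cQ n| * cPPs 4 a + cPs 4 a ≤ C₁ := by rw [hC₁]; exact add_le_add (mul_le_mul_of_nonneg_right (hcQ n) hcP) le_rfl
  have hexpl : ∀ {ε' : ℝ} (_ : ε ≤ ε') (t : ℝ), 0 ≤ t → Real.exp (-(ε' / n) * t) ≤ Real.exp (-(ε / n) * t) := fun hle t ht =>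
    Real.exp_le_exp.2 (by rw [neg_mul, neg_mul, neg_le_neg_iff]; exact mul_le_mul_of_nonneg_right (div_le_div_of_nonneg_right hle hn.le) ht)
  -- the letters at this `n`, at the common rate `ε` and the common prefactor `C₁`
  have hΦn : ∀ (κ : Fin 4) (u x : Pt) (α : Fin 4), |applyK (Ga n a) (grad (ndlRow n a κ u)) x α|
      ≤ kΦ / (n : ℝ) ^ 2 * ∑ s ∈ B (n - 1) (blk (n - 1) u), |qJet n κ u (blk (n - 1) u) s|
          * (Real.exp (-(ε / n) * PoissonInterior.supNorm (d := 4) (x - s)) / nrm (x - s) ^ 1) :=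
    fun κ u x α => (hΦ n κ u x α).trans (mul_le_mul_of_nonneg_left (Finset.sum_le_sum fun s _ => mul_le_mul_of_nonneg_left
      (div_le_div_of_nonneg_right (hexpl hl0 _ (Nat.cast_nonneg _)) (pow_nonneg (nrm_pos _).le 1)) (abs_nonneg _)) (by positivity))
  have hΦ'n : ∀ (κ : Fin 4) (u x : Pt) (α i : Fin 4), |applyK (Ga n a) (grad (ndlRow n a κ u)) (x + unitVec i) α - applyK (Ga n a) (grad (ndlRow n a κ u)) x α|
      ≤ kΦ' / (n : ℝ) ^ 2 * ∑ s ∈ B (n - 1) (blk (n - 1) u), |qJet n κ u (blk (n - 1) u) s|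
          * (Real.exp (-(ε / n) * PoissonInterior.supNorm (d := 4) (x - s)) / nrm (x - s) ^ 2) :=
    fun κ u x α i => (hΦ' n κ u x α i).trans (mul_le_mul_of_nonneg_left (Finset.sum_le_sum fun s _ => mul_le_mul_of_nonneg_left
      (div_le_div_of_nonneg_right (hexpl hl1 _ (Nat.cast_nonneg _)) (pow_nonneg (nrm_pos _).le 2)) (abs_nonneg _)) (by positivity))
  have hNn : ∀ (u x : Pt) (α : Fin 4), |applyK (Ga n a) (grad (fun q => cQ n * (∑ z ∈ B (n - 1) (blk (n - 1) u), Pgt n a z q () ())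
      - kerP (d := 4) (n - 1) a q (blk (n - 1) u))) x α| ≤ kN * C₁ * (n : ℝ) :=
    fun u x α => (hN n (cQ n) u x α).trans ((mul_le_of_le_one_right (by positivity) (by
      rw [Real.exp_le_one_iff]; have : 0 ≤ δ₂ * dist (blk (n - 1) x) (blk (n - 1) u) := by positivity
      linarith)).trans (mul_le_mul_of_nonneg_right (mul_le_mul_of_nonneg_left hC₀ hkN) hn.le))
  have hN'n : ∀ (u x : Pt) (α i : Fin 4), |applyK (Ga n a) (grad (fun q => cQ n * (∑ z ∈ B (n - 1) (blk (n - 1) u), Pgt n a z q () ())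
      - kerP (d := 4) (n - 1) a q (blk (n - 1) u))) (x + unitVec i) α
      - applyK (Ga n a) (grad (fun q => cQ n * (∑ z ∈ B (n - 1) (blk (n - 1) u), Pgt n a z q () ()) - kerP (d := 4) (n - 1) a q (blk (n - 1) u))) x α|
      ≤ kN' * C₁ := fun u x α i => (hN' n (cQ n) u x α i).trans (mul_le_mul_of_nonneg_left hC₀ hkN')
  -- one base site: `q_b·G_n` with `G_n ≤ n³·G₀`
  have hGn : K * ((kΦ' / (n : ℝ) ^ 2 * c₂ * (2 * (A₂ * (n : ℝ) ^ (4 - 2 + 2)) + 2 * (n : ℝ) ^ 2 * (B₂ * (n : ℝ) ^ (4 - 2 + 0)))) * (kN * C₁ * (n : ℝ) + kN' * C₁)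
      + (kΦ / (n : ℝ) ^ 2 * c₁ * (2 * (A₁ * (n : ℝ) ^ (4 - 1 + 2)) + 2 * (n : ℝ) ^ 2 * (B₁ * (n : ℝ) ^ (4 - 1 + 0)))) * (kN' * C₁))
      ≤ (n : ℝ) ^ 3 * G₀ := by
    rw [show (4 - 2 + 2 : ℕ) = 4 by norm_num, show (4 - 2 + 0 : ℕ) = 2 by norm_num, show (4 - 1 + 2 : ℕ) = 5 by norm_num,
      show (4 - 1 + 0 : ℕ) = 3 by norm_num]
    have e1 : K * ((kΦ' / (n : ℝ) ^ 2 * c₂ * (2 * (A₂ * (n : ℝ) ^ 4) + 2 * (n : ℝ) ^ 2 * (B₂ * (n : ℝ) ^ 2))) * (kN * C₁ * (n : ℝ) + kN' * C₁)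
        + (kΦ / (n : ℝ) ^ 2 * c₁ * (2 * (A₁ * (n : ℝ) ^ 5) + 2 * (n : ℝ) ^ 2 * (B₁ * (n : ℝ) ^ 3))) * (kN' * C₁))
        = (n : ℝ) ^ 2 * (K * C₁ * (kΦ' * c₂ * (2 * A₂ + 2 * B₂) * (kN * (n : ℝ) + kN'))) + (n : ℝ) ^ 3 * (K * C₁ * (kΦ * c₁ * (2 * A₁ + 2 * B₁) * kN')) := by
      field_simp
    rw [e1, hG₀]
    have h2 : kN * (n : ℝ) + kN' ≤ (kN + kN') * (n : ℝ) := by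
      calc kN * (n : ℝ) + kN' = kN * (n : ℝ) + kN' * 1 := by ring
        _ ≤ kN * (n : ℝ) + kN' * (n : ℝ) := add_le_add le_rfl (mul_le_mul_of_nonneg_left hn1 hkN')
        _ = (kN + kN') * (n : ℝ) := by ring
    have h3 : (n : ℝ) ^ 2 * (K * C₁ * (kΦ' * c₂ * (2 * A₂ + 2 * B₂) * (kN * (n : ℝ) + kN')))
        ≤ (n : ℝ) ^ 3 * (K * C₁ * (kΦ' * c₂ * (2 * A₂ + 2 * B₂) * (kN + kN'))) := by
      have h4 : 0 ≤ (n : ℝ) ^ 2 * (K * C₁ * (kΦ' * c₂ * (2 * A₂ + 2 * B₂))) := by positivity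
      calc (n : ℝ) ^ 2 * (K * C₁ * (kΦ' * c₂ * (2 * A₂ + 2 * B₂) * (kN * (n : ℝ) + kN')))
          = (n : ℝ) ^ 2 * (K * C₁ * (kΦ' * c₂ * (2 * A₂ + 2 * B₂))) * (kN * (n : ℝ) + kN') := by ring
        _ ≤ (n : ℝ) ^ 2 * (K * C₁ * (kΦ' * c₂ * (2 * A₂ + 2 * B₂))) * ((kN + kN') * (n : ℝ)) := mul_le_mul_of_nonneg_left h2 h4
        _ = (n : ℝ) ^ 3 * (K * C₁ * (kΦ' * c₂ * (2 * A₂ + 2 * B₂) * (kN + kN'))) := by ring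
    calc (n : ℝ) ^ 2 * (K * C₁ * (kΦ' * c₂ * (2 * A₂ + 2 * B₂) * (kN * (n : ℝ) + kN'))) + (n : ℝ) ^ 3 * (K * C₁ * (kΦ * c₁ * (2 * A₁ + 2 * B₁) * kN'))
        ≤ (n : ℝ) ^ 3 * (K * C₁ * (kΦ' * c₂ * (2 * A₂ + 2 * B₂) * (kN + kN'))) + (n : ℝ) ^ 3 * (K * C₁ * (kΦ * c₁ * (2 * A₁ + 2 * B₁) * kN')) :=
          add_le_add h3 le_rfl
      _ = _ := by ring
  have hsite : ∀ b : Pt, |fullSum (fun w : Pt => toReal w μ * toReal w ν *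
      biBubbleTable (Ga n a) (Ga n a) SbT (ndlPiece n a (cQ n)) μ ν (b + w) b)|
      ≤ (∑ s ∈ B (n - 1) (blk (n - 1) b), |qJet n ν b (blk (n - 1) b) s|) * ((n : ℝ) ^ 3 * G₀) := by
    intro b
    have h := abs_fullSum_locNdl_le n a ha hA hK hframe (KΦ := kΦ / (n : ℝ) ^ 2) (KΦ' := kΦ' / (n : ℝ) ^ 2) (KN := kN * C₁ * (n : ℝ)) (KN' := kN' * C₁)
      (by positivity) (by positivity) (by positivity) (by positivity) hε hΦn hΦ'n hNn hN'n μ ν b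
    rw [← hc₁, ← hc₂, ← hA₂, ← hB₂, ← hA₁, ← hB₁] at h
    exact h.trans (mul_le_mul_of_nonneg_left hGn (Finset.sum_nonneg fun s _ => abs_nonneg _))
  -- the base average pays the census
  rw [cellSum_def]
  refine (Finset.abs_sum_le_sum_abs _ _).trans ?_
  have hq := sum_resSite_needle_weight_le (n := n) ν
  calc ∑ b ∈ (univ : Finset (Fin 4 → Fin n)).image resSite, |((n : ℝ) ^ 4)⁻¹ *
        fullSum (fun w : Pt => toReal w μ * toReal w ν * biBubbleTable (Ga n a) (Ga n a) SbT (ndlPiece n a (cQ n)) μ ν (b + w) b)|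
      ≤ ∑ b ∈ (univ : Finset (Fin 4 → Fin n)).image resSite, ((n : ℝ) ^ 4)⁻¹ *
          ((∑ s ∈ B (n - 1) (blk (n - 1) b), |qJet n ν b (blk (n - 1) b) s|) * ((n : ℝ) ^ 3 * G₀)) := by
        refine Finset.sum_le_sum fun b _ => ?_
        rw [abs_mul, abs_of_nonneg (by positivity : (0 : ℝ) ≤ ((n : ℝ) ^ 4)⁻¹)]
        exact mul_le_mul_of_nonneg_left (hsite b) (by positivity)
    _ = ((n : ℝ) ^ 4)⁻¹ * ((n : ℝ) ^ 3 * G₀) *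
          ∑ b ∈ (univ : Finset (Fin 4 → Fin n)).image resSite, ∑ s ∈ B (n - 1) (blk (n - 1) b), |qJet n ν b (blk (n - 1) b) s| := by
        rw [Finset.mul_sum]; exact Finset.sum_congr rfl fun b _ => by ring
    _ ≤ ((n : ℝ) ^ 4)⁻¹ * ((n : ℝ) ^ 3 * G₀) * ((n : ℝ) - 1) := mul_le_mul_of_nonneg_left hq (by positivity)
    _ = (((n : ℝ) - 1) / (n : ℝ)) * G₀ := by field_simp
    _ ≤ 1 * G₀ := mul_le_mul_of_nonneg_right ((div_le_one hn).2 (sub_le_self _ zero_le_one)) hG₀0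
    _ = G₀ := one_mul _

end Summit.QuantumFields.BalabanUV.Beta.D1BFx.GluonLocalNdlRow

end
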